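import Summits.CriticalPhenomena.Ising3D.Control2DIsingChiral
import Summits.CriticalPhenomena.Ising3D.Control2DVertexSectors
import Mathlib.Tactic
import HarnessLib

/-!
# The 2D Ising witness, VII: `⟨σσσσ⟩` of the 2D Ising CFT as a `CrossingData` at `Δ_σ = 1/8`
(cell `pub-ising3x`, seat controls-1 gen 37; NON-VACUITY of the 2D control's `A2D′` classes at
`Δ_σ = 1/8` by the Ising datum, step 7 — CONTROL-ONLY)

HONEST FRAMING: lottery ticket; floor = tightest certified 3D Ising CFT bounds; no exact-solution
claim without a proof. CONTROL-ONLY (`d = 2`); this file is about the two-dimensional Ising CFT only.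

The datum `isingData2D`: the quasi-primary content of `g(z,z̄) = f₁(z)f₁(z̄) + f₂(z)f₂(z̄)`
(Belavin–Polyakov–Zamolodchikov 1984; `f₁, f₂` the `c = 1/2` Virasoro blocks of `𝟙` and `ε`,
`Control2DIsingChiral`) in the tree's conventions (`Control2DBootstrap`): identity-module pairs
`(h,h̄) = (2j, 2j')`, `j ≥ j'`, `(j,j') ≠ (0,0)`, with `p = A_j A_{j'}` (`j > j'`) / `A_j²/2` (`j = j'`);
`ε`-module pairs `(h,h̄) = (2j+1/2, 2j'+1/2)`, `j ≥ j'`, with `p = B_j B_{j'}` / `B_j²/2`. Proved here: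

* `hasSum_isingData2D_blocks` : `Σ_i p_i g_{Δ_i,ℓ_i}(z,z̄) = f₁(z)f₁(z̄) - 1 + f₂(z)f₂(z̄)`;
* `isingData2D_isUnitary`     : even spins, `Δ ≥ ℓ`, `p ≥ 0` (`A_j > 0`, `B_j ≥ 0`);
* `isingData2D_satisfiesCrossing` : the `⟨σσσσ⟩` sum rule at **`Δ_σ = 1/8`** — from the elementary
  crossing identity `H(z,z̄) = H(1-z,1-z̄)`, `H = w₁⊗w₁ + w₂⊗w₂ = ½(√(1+√z)√(1+√z̄) + √(1-√z)√(1-√z̄))`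
  (`ising_crossing_identity`, proved by squaring).

The spectrum (`Δ_ε = 1`, scalars `{1} ∪ [4,∞)`, spin 2 in `{2} ∪ [3,∞)`, `p_T = 1/64`, `p_ε = 1/8`)
and the record consequences are in `Control2DIsingSpectrum` / `Control2DIsingNonVacuity`. Labels with a
vanishing coefficient (`B_1 = 0`: `(h,h̄) ∋ 5/2`) are kept; they are harmless for every typed class.

References: A. A. Belavin, A. M. Polyakov, A. B. Zamolodchikov, Nucl. Phys. B 241 (1984) 333, §5, App. E
[cite: BelavinPolyakovZamolodchikov1984, App. E]; R. Rattazzi, V. S. Rychkov, E. Tonni, A. Vichi,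
JHEP 12 (2008) 031, §3 eq. (3.6) [cite: RattazziEtAl2008, §3 eq. (3.6)]. Tree: `CrossingData`,
`globalBlock`, `crossF`, `foldPairs`, `hasSum_foldPairs`, `hasSum_isingA_blocks`, `hasSum_isingB_blocks`.
-/

namespace Summit.CriticalPhenomena.Ising3D.Control2D

open Finset Set
open Literature.MathematicalPhysics.QuantumFieldTheory.ConformalBootstrap3D

section Data

variable {z zb : ℝ}

/-! ### The two double families -/

/-- Identity-module double family `[(j,j') ≠ (0,0)] A_j A_{j'} k_{4j}(z) k_{4j'}(z̄)`. [folklore] -/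
noncomputable def isingIdDouble (z zb : ℝ) (jj : ℕ × ℕ) : ℝ :=
  if jj ≠ (0, 0) then isingA jj.1 * isingA jj.2 * (chiralBlock (2 * jj.1) z * chiralBlock (2 * jj.2) zb)
  else 0

/-- `ε`-module double family `B_j B_{j'} k_{4j+1}(z) k_{4j'+1}(z̄)`. [folklore] -/
noncomputable def isingEpDouble (z zb : ℝ) (jj : ℕ × ℕ) : ℝ :=
  isingB jj.1 * isingB jj.2 * (chiralBlock (1 / 2 + 2 * jj.1) z * chiralBlock (1 / 2 + 2 * jj.2) zb)

/-- The identity family is non-negative on the open square. [folklore] -/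
theorem isingIdDouble_nonneg (hz : z ∈ Ioo (0 : ℝ) 1) (hzb : zb ∈ Ioo (0 : ℝ) 1) (jj : ℕ × ℕ) :
    0 ≤ isingIdDouble z zb jj := by
  unfold isingIdDouble
  split_ifs
  · have h1 := isingA_nonneg jj.1
    have h2 := isingA_nonneg jj.2
    have h3 := chiralBlock_nonneg (by positivity : (0 : ℝ) ≤ 2 * jj.1) hz
    have h4 := chiralBlock_nonneg (by positivity : (0 : ℝ) ≤ 2 * jj.2) hzb
    positivity
  · exact le_rfl

/-- The `ε` family is non-negative on the open square. [folklore] -/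
theorem isingEpDouble_nonneg (hz : z ∈ Ioo (0 : ℝ) 1) (hzb : zb ∈ Ioo (0 : ℝ) 1) (jj : ℕ × ℕ) :
    0 ≤ isingEpDouble z zb jj := by
  unfold isingEpDouble
  have h1 := isingB_nonneg jj.1
  have h2 := isingB_nonneg jj.2
  have h3 := chiralBlock_nonneg (by positivity : (0 : ℝ) ≤ 1 / 2 + 2 * jj.1) hz
  have h4 := chiralBlock_nonneg (by positivity : (0 : ℝ) ≤ 1 / 2 + 2 * jj.2) hzb
  positivity

/-- **`Σ_{(j,j') ≠ (0,0)} A_j A_{j'} k_{4j}(z) k_{4j'}(z̄) = f₁(z) f₁(z̄) - 1`.** [cite: BelavinPolyakovZamolodchikov1984, App. E] -/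
theorem hasSum_isingIdDouble (hz : z ∈ Ioo (0 : ℝ) 1) (hzb : zb ∈ Ioo (0 : ℝ) 1) :
    HasSum (isingIdDouble z zb) (isingF₁ z * isingF₁ zb - 1) := by
  obtain ⟨f, hf_def⟩ : ∃ f : ℕ → ℝ, f = fun j => isingA j * chiralBlock (2 * j) z := ⟨_, rfl⟩
  obtain ⟨g, hg_def⟩ : ∃ g : ℕ → ℝ, g = fun j => isingA j * chiralBlock (2 * j) zb := ⟨_, rfl⟩
  have hf : HasSum f (isingF₁ z) := hf_def ▸ hasSum_isingA_blocks hz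
  have hg : HasSum g (isingF₁ zb) := hg_def ▸ hasSum_isingA_blocks hzb
  have hf0 : 0 ≤ f := fun j => by
    rw [hf_def]; exact mul_nonneg (isingA_nonneg j) (chiralBlock_nonneg (by positivity) hz)
  have hg0 : 0 ≤ g := fun j => by
    rw [hg_def]; exact mul_nonneg (isingA_nonneg j) (chiralBlock_nonneg (by positivity) hzb)
  have hP : Summable fun jj : ℕ × ℕ => f jj.1 * g jj.2 := hf.summable.mul_of_nonneg hg.summable hf0 hg0
  have P := hf.mul hg hP
  have T := P.sub (hasSum_ite_eq ((0, 0) : ℕ × ℕ) (1 : ℝ))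
  refine T.congr_fun fun jj => ?_
  obtain ⟨j, j'⟩ := jj
  simp only [hf_def, hg_def, isingIdDouble]
  by_cases h0 : ((j, j') : ℕ × ℕ) = (0, 0)
  · simp only [Prod.mk.injEq] at h0
    obtain ⟨rfl, rfl⟩ := h0
    simp [chiralBlock_zero]
  · rw [if_pos h0, if_neg h0]
    ring

/-- **`Σ B_j B_{j'} k_{4j+1}(z) k_{4j'+1}(z̄) = f₂(z) f₂(z̄)`.** [cite: BelavinPolyakovZamolodchikov1984, App. E] -/
theorem hasSum_isingEpDouble (hz : z ∈ Ioo (0 : ℝ) 1) (hzb : zb ∈ Ioo (0 : ℝ) 1) :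
    HasSum (isingEpDouble z zb) (isingF₂ z * isingF₂ zb) := by
  obtain ⟨f, hf_def⟩ : ∃ f : ℕ → ℝ, f = fun j => isingB j * chiralBlock (1 / 2 + 2 * j) z := ⟨_, rfl⟩
  obtain ⟨g, hg_def⟩ : ∃ g : ℕ → ℝ, g = fun j => isingB j * chiralBlock (1 / 2 + 2 * j) zb := ⟨_, rfl⟩
  have hf : HasSum f (isingF₂ z) := hf_def ▸ hasSum_isingB_blocks hz
  have hg : HasSum g (isingF₂ zb) := hg_def ▸ hasSum_isingB_blocks hzb
  have hf0 : 0 ≤ f := fun j => by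
    rw [hf_def]; exact mul_nonneg (isingB_nonneg j) (chiralBlock_nonneg (by positivity) hz)
  have hg0 : 0 ≤ g := fun j => by
    rw [hg_def]; exact mul_nonneg (isingB_nonneg j) (chiralBlock_nonneg (by positivity) hzb)
  have hP : Summable fun jj : ℕ × ℕ => f jj.1 * g jj.2 := hf.summable.mul_of_nonneg hg.summable hf0 hg0
  refine (hf.mul hg hP).congr_fun fun jj => ?_
  simp only [hf_def, hg_def, isingEpDouble]
  ring

/-! ### The datum -/

/-- Identity-module labels `(j, j')`, `j' ≤ j`, `(j,j') ≠ (0,0)`: the pair `(h,h̄) = (2j,2j')`. [folklore] -/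
abbrev IsingIdLabel : Type := {jj : ℕ × ℕ // jj.2 ≤ jj.1 ∧ jj ≠ (0, 0)}

/-- `ε`-module labels `(j, j')`, `j' ≤ j`: the pair `(h,h̄) = (2j+1/2, 2j'+1/2)`. [folklore] -/
abbrev IsingEpLabel : Type := {jj : ℕ × ℕ // jj.2 ≤ jj.1}

/-- **`⟨σσσσ⟩` of the 2D Ising CFT as a `CrossingData`**: the quasi-primaries of the identity and `ε`
Virasoro modules, each unordered pair `(h,h̄)` entered once with `Δ = h + h̄`, `ℓ = h - h̄` and the product
of chiral coefficients (halved on the diagonal, matching `globalBlock Δ 0 = 2 k k`).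
[cite: BelavinPolyakovZamolodchikov1984, App. E] -/
noncomputable def isingData2D : CrossingData where
  ι := IsingIdLabel ⊕ IsingEpLabel
  Δ := fun i => match i with
    | Sum.inl a => 2 * (a.1.1 : ℝ) + 2 * (a.1.2 : ℝ)
    | Sum.inr b => 2 * (b.1.1 : ℝ) + 2 * (b.1.2 : ℝ) + 1
  spin := fun i => match i with
    | Sum.inl a => 2 * (a.1.1 - a.1.2)
    | Sum.inr b => 2 * (b.1.1 - b.1.2)
  p := fun i => match i with
    | Sum.inl a => if a.1.2 < a.1.1 then isingA a.1.1 * isingA a.1.2 else isingA a.1.1 ^ 2 / 2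
    | Sum.inr b => if b.1.2 < b.1.1 then isingB b.1.1 * isingB b.1.2 else isingB b.1.1 ^ 2 / 2

/-- The block of an identity label: `k_{4j}(z) k_{4j'}(z̄) + k_{4j'}(z) k_{4j}(z̄)`. [cite: DolanOsborn2004, §3] -/
theorem globalBlock_isingId {j j' : ℕ} (h : j' ≤ j) (z zb : ℝ) :
    globalBlock (2 * (j : ℝ) + 2 * (j' : ℝ)) (2 * (j - j')) z zb =
      chiralBlock (2 * j) z * chiralBlock (2 * j') zb + chiralBlock (2 * j') z * chiralBlock (2 * j) zb := by
  unfold globalBlock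
  push_cast
  rw [Nat.cast_sub h, show ((2 * (j : ℝ) + 2 * j') + 2 * ((j : ℝ) - j')) / 2 = 2 * j by ring,
    show ((2 * (j : ℝ) + 2 * j') - 2 * ((j : ℝ) - j')) / 2 = 2 * j' by ring]

/-- The block of an `ε` label: `k_{4j+1}(z) k_{4j'+1}(z̄) + k_{4j'+1}(z) k_{4j+1}(z̄)`. [cite: DolanOsborn2004, §3] -/
theorem globalBlock_isingEp {j j' : ℕ} (h : j' ≤ j) (z zb : ℝ) :
    globalBlock (2 * (j : ℝ) + 2 * (j' : ℝ) + 1) (2 * (j - j')) z zb =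
      chiralBlock (1 / 2 + 2 * j) z * chiralBlock (1 / 2 + 2 * j') zb +
        chiralBlock (1 / 2 + 2 * j') z * chiralBlock (1 / 2 + 2 * j) zb := by
  unfold globalBlock
  push_cast
  rw [Nat.cast_sub h, show ((2 * (j : ℝ) + 2 * j' + 1) + 2 * ((j : ℝ) - j')) / 2 = 1 / 2 + 2 * j by ring,
    show ((2 * (j : ℝ) + 2 * j' + 1) - 2 * ((j : ℝ) - j')) / 2 = 1 / 2 + 2 * j' by ring]

/-- The identity part of `Σ p_i g_i`: the folded family equals `p · g` on the labels. [folklore] -/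
theorem foldPairs_isingId (z zb : ℝ) (jj : ℕ × ℕ) :
    foldPairs (isingIdDouble z zb) jj =
      if h : jj.2 ≤ jj.1 ∧ jj ≠ (0, 0) then
        isingData2D.p (Sum.inl ⟨jj, h⟩) *
          globalBlock (isingData2D.Δ (Sum.inl ⟨jj, h⟩)) (isingData2D.spin (Sum.inl ⟨jj, h⟩)) z zb
      else 0 := by
  obtain ⟨j, j'⟩ := jj
  simp only [foldPairs, isingIdDouble, isingData2D, Prod.swap_prod_mk]
  by_cases hlt : j' < j
  · have hne : ((j, j') : ℕ × ℕ) ≠ (0, 0) := by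
      intro h; simp only [Prod.mk.injEq] at h; omega
    have hne' : ((j', j) : ℕ × ℕ) ≠ (0, 0) := by
      intro h; simp only [Prod.mk.injEq] at h; omega
    rw [if_pos hlt, if_pos hne, if_pos hne', dif_pos ⟨hlt.le, hne⟩]
    simp only [if_pos hlt]
    rw [globalBlock_isingId hlt.le]
    ring
  · by_cases heq : j' = j
    · subst heq
      rw [if_neg hlt, if_pos rfl]
      by_cases h0 : ((j', j') : ℕ × ℕ) = (0, 0)
      · rw [if_neg (fun h => h h0), dif_neg (fun h => h.2 h0)]
      · rw [if_pos h0, dif_pos ⟨le_rfl, h0⟩]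
        simp only [lt_irrefl, if_false]
        rw [globalBlock_isingId le_rfl]
        ring
    · rw [if_neg hlt, if_neg heq, dif_neg (fun h => by omega)]

/-- The `ε` part of `Σ p_i g_i`. [folklore] -/
theorem foldPairs_isingEp (z zb : ℝ) (jj : ℕ × ℕ) :
    foldPairs (isingEpDouble z zb) jj =
      if h : jj.2 ≤ jj.1 then
        isingData2D.p (Sum.inr ⟨jj, h⟩) *
          globalBlock (isingData2D.Δ (Sum.inr ⟨jj, h⟩)) (isingData2D.spin (Sum.inr ⟨jj, h⟩)) z zb
      else 0 := by
  obtain ⟨j, j'⟩ := jj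
  simp only [foldPairs, isingEpDouble, isingData2D, Prod.swap_prod_mk]
  by_cases hlt : j' < j
  · rw [if_pos hlt, dif_pos hlt.le]
    simp only [if_pos hlt]
    rw [globalBlock_isingEp hlt.le]
    ring
  · by_cases heq : j' = j
    · subst heq
      rw [if_neg hlt, if_pos rfl, dif_pos le_rfl]
      simp only [lt_irrefl, if_false]
      rw [globalBlock_isingEp le_rfl]
      ring
    · rw [if_neg hlt, if_neg heq, dif_neg (by omega)]

/-- **Block expansion of `⟨σσσσ⟩`**: for `(z, z̄)` in the open square,
`Σ_i p_i g_{Δ_i,ℓ_i}(z,z̄) = (f₁(z) f₁(z̄) - 1) + f₂(z) f₂(z̄) = g(z,z̄) - 1`.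
[cite: BelavinPolyakovZamolodchikov1984, App. E] -/
theorem hasSum_isingData2D_blocks (hz : z ∈ Ioo (0 : ℝ) 1) (hzb : zb ∈ Ioo (0 : ℝ) 1) :
    HasSum (fun i : isingData2D.ι => isingData2D.p i * globalBlock (isingData2D.Δ i) (isingData2D.spin i) z zb)
      ((isingF₁ z * isingF₁ zb - 1) + isingF₂ z * isingF₂ zb) := by
  have hI := hasSum_foldPairs (isingIdDouble_nonneg hz hzb) (hasSum_isingIdDouble hz hzb)
  have hE := hasSum_foldPairs (isingEpDouble_nonneg hz hzb) (hasSum_isingEpDouble hz hzb)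
  have hIsupp : Function.support (foldPairs (isingIdDouble z zb)) ⊆
      {jj : ℕ × ℕ | jj.2 ≤ jj.1 ∧ jj ≠ (0, 0)} := by
    intro jj hjj
    by_contra h
    rw [Set.mem_setOf_eq] at h
    exact hjj (by rw [foldPairs_isingId, dif_neg h])
  have hEsupp : Function.support (foldPairs (isingEpDouble z zb)) ⊆ {jj : ℕ × ℕ | jj.2 ≤ jj.1} := by
    intro jj hjj
    by_contra h
    rw [Set.mem_setOf_eq] at h
    exact hjj (by rw [foldPairs_isingEp, dif_neg h])
  have hI' := (hasSum_subtype_iff_of_support_subset hIsupp).2 hI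
  have hE' := (hasSum_subtype_iff_of_support_subset hEsupp).2 hE
  refine HasSum.sum ?_ ?_
  · refine hI'.congr_fun fun a => ?_
    obtain ⟨jj, h⟩ := a
    have h' : jj.2 ≤ jj.1 ∧ jj ≠ (0, 0) := h
    show _ = foldPairs (isingIdDouble z zb) jj
    rw [foldPairs_isingId, dif_pos h']
    rfl
  · refine hE'.congr_fun fun b => ?_
    obtain ⟨jj, h⟩ := b
    have h' : jj.2 ≤ jj.1 := h
    show _ = foldPairs (isingEpDouble z zb) jj
    rw [foldPairs_isingEp, dif_pos h']
    rfl

/-- **Unitarity** of the Ising datum: even spins, `Δ ≥ ℓ`, `p ≥ 0` (`A_j > 0`, `B_j ≥ 0`).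
[cite: RattazziEtAl2008, §3] -/
theorem isingData2D_isUnitary : isingData2D.IsUnitary := by
  rintro (⟨⟨j, j'⟩, hle, hne⟩ | ⟨⟨j, j'⟩, hle⟩)
  · refine ⟨show Even (2 * (j - j')) from even_two_mul _, ?_, ?_⟩
    · show ((2 * (j - j') : ℕ) : ℝ) ≤ 2 * (j : ℝ) + 2 * (j' : ℝ)
      push_cast
      rw [Nat.cast_sub hle]
      have : (0 : ℝ) ≤ j' := Nat.cast_nonneg j'
      linarith
    · show 0 ≤ (if j' < j then isingA j * isingA j' else isingA j ^ 2 / 2)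
      have h1 := isingA_nonneg j
      have h2 := isingA_nonneg j'
      split_ifs <;> positivity
  · refine ⟨show Even (2 * (j - j')) from even_two_mul _, ?_, ?_⟩
    · show ((2 * (j - j') : ℕ) : ℝ) ≤ 2 * (j : ℝ) + 2 * (j' : ℝ) + 1
      push_cast
      rw [Nat.cast_sub hle]
      have : (0 : ℝ) ≤ j' := Nat.cast_nonneg j'
      linarith
    · show 0 ≤ (if j' < j then isingB j * isingB j' else isingB j ^ 2 / 2)
      have h1 := isingB_nonneg j
      have h2 := isingB_nonneg j'
      split_ifs <;> positivity

/-! ### Crossing -/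

/-- **The crossing identity of the 2D Ising four-point function**, elementary form:
`√(1+√z)√(1+√z̄) + √(1-√z)√(1-√z̄)` is invariant under `(z,z̄) ↦ (1-z,1-z̄)` on the open square (both sides
are non-negative with equal squares `2 + 2√z√z̄ + 2√(1-z)√(1-z̄)`). [cite: BelavinPolyakovZamolodchikov1984, §5] -/
theorem ising_crossing_identity (hz : z ∈ Ioo (0 : ℝ) 1) (hzb : zb ∈ Ioo (0 : ℝ) 1) :
    Real.sqrt (1 + Real.sqrt z) * Real.sqrt (1 + Real.sqrt zb) +
        Real.sqrt (1 - Real.sqrt z) * Real.sqrt (1 - Real.sqrt zb) =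
      Real.sqrt (1 + Real.sqrt (1 - z)) * Real.sqrt (1 + Real.sqrt (1 - zb)) +
        Real.sqrt (1 - Real.sqrt (1 - z)) * Real.sqrt (1 - Real.sqrt (1 - zb)) := by
  -- squares of both sides
  have key : ∀ a b : ℝ, a ∈ Ioo (0 : ℝ) 1 → b ∈ Ioo (0 : ℝ) 1 →
      (Real.sqrt (1 + Real.sqrt a) * Real.sqrt (1 + Real.sqrt b) +
        Real.sqrt (1 - Real.sqrt a) * Real.sqrt (1 - Real.sqrt b)) ^ 2 =
        2 + 2 * (Real.sqrt a * Real.sqrt b) + 2 * (Real.sqrt (1 - a) * Real.sqrt (1 - b)) := by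
    intro a b ha hb
    have ha1 : Real.sqrt a ≤ 1 := Real.sqrt_le_one.mpr ha.2.le
    have hb1 : Real.sqrt b ≤ 1 := Real.sqrt_le_one.mpr hb.2.le
    have hpa : 0 ≤ 1 + Real.sqrt a := by positivity
    have hma : 0 ≤ 1 - Real.sqrt a := by linarith
    have hpb : 0 ≤ 1 + Real.sqrt b := by positivity
    have hmb : 0 ≤ 1 - Real.sqrt b := by linarith
    have e1 : Real.sqrt (1 + Real.sqrt a) * Real.sqrt (1 - Real.sqrt a) = Real.sqrt (1 - a) := by
      rw [← Real.sqrt_mul hpa, show (1 + Real.sqrt a) * (1 - Real.sqrt a) = 1 - Real.sqrt a ^ 2 by ring,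
        Real.sq_sqrt ha.1.le]
    have e2 : Real.sqrt (1 + Real.sqrt b) * Real.sqrt (1 - Real.sqrt b) = Real.sqrt (1 - b) := by
      rw [← Real.sqrt_mul hpb, show (1 + Real.sqrt b) * (1 - Real.sqrt b) = 1 - Real.sqrt b ^ 2 by ring,
        Real.sq_sqrt hb.1.le]
    have s1 := Real.sq_sqrt hpa
    have s2 := Real.sq_sqrt hma
    have s3 := Real.sq_sqrt hpb
    have s4 := Real.sq_sqrt hmb
    have expand : (Real.sqrt (1 + Real.sqrt a) * Real.sqrt (1 + Real.sqrt b) +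
        Real.sqrt (1 - Real.sqrt a) * Real.sqrt (1 - Real.sqrt b)) ^ 2 =
        Real.sqrt (1 + Real.sqrt a) ^ 2 * Real.sqrt (1 + Real.sqrt b) ^ 2 +
          Real.sqrt (1 - Real.sqrt a) ^ 2 * Real.sqrt (1 - Real.sqrt b) ^ 2 +
          2 * (Real.sqrt (1 + Real.sqrt a) * Real.sqrt (1 - Real.sqrt a)) *
            (Real.sqrt (1 + Real.sqrt b) * Real.sqrt (1 - Real.sqrt b)) := by ring
    rw [expand, s1, s2, s3, s4, e1, e2]
    ring
  have hz' : 1 - z ∈ Ioo (0 : ℝ) 1 := ⟨by linarith [hz.2], by linarith [hz.1]⟩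
  have hzb' : 1 - zb ∈ Ioo (0 : ℝ) 1 := ⟨by linarith [hzb.2], by linarith [hzb.1]⟩
  have k1 := key z zb hz hzb
  have k2 := key (1 - z) (1 - zb) hz' hzb'
  rw [show 1 - (1 - z) = z by ring, show 1 - (1 - zb) = zb by ring] at k2
  have hL : 0 ≤ Real.sqrt (1 + Real.sqrt z) * Real.sqrt (1 + Real.sqrt zb) +
      Real.sqrt (1 - Real.sqrt z) * Real.sqrt (1 - Real.sqrt zb) := by positivity
  have hR : 0 ≤ Real.sqrt (1 + Real.sqrt (1 - z)) * Real.sqrt (1 + Real.sqrt (1 - zb)) +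
      Real.sqrt (1 - Real.sqrt (1 - z)) * Real.sqrt (1 - Real.sqrt (1 - zb)) := by positivity
  refine (pow_left_inj₀ hL hR two_ne_zero).mp ?_
  rw [k1, k2]
  ring

/-- `v^{1/8} f_i(z) f_i(z̄) = w_i(z) w_i(z̄)`: the prefactors cancel. [folklore] -/
theorem ising_prefactor (hz : z ∈ Ioo (0 : ℝ) 1) (hzb : zb ∈ Ioo (0 : ℝ) 1) (a b : ℝ) :
    ((1 - z) * (1 - zb)) ^ (1 / 8 : ℝ) * ((1 / (1 - z) ^ (1 / 8 : ℝ) * a) * (1 / (1 - zb) ^ (1 / 8 : ℝ) * b))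
      = a * b := by
  have h1 : 0 < 1 - z := by linarith [hz.2]
  have h2 : 0 < 1 - zb := by linarith [hzb.2]
  have p1 : 0 < (1 - z) ^ (1 / 8 : ℝ) := Real.rpow_pos_of_pos h1 _
  have p2 : 0 < (1 - zb) ^ (1 / 8 : ℝ) := Real.rpow_pos_of_pos h2 _
  rw [Real.mul_rpow h1.le h2.le]
  field_simp

/-- **Crossing symmetry of the 2D Ising four-point function at `Δ_σ = 1/8`** in the tree's conventions:
`Σ_i p_i F_-[g_i](z,z̄) = -F_-[1](z,z̄)`, i.e. `v^{1/8} g(z,z̄) = u^{1/8} g(1-z,1-z̄)`.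
[cite: BelavinPolyakovZamolodchikov1984, §5] -/
theorem isingData2D_satisfiesCrossing : isingData2D.SatisfiesCrossing (1 / 8) := by
  intro z zb hz hzb
  have hz' : 1 - z ∈ Ioo (0 : ℝ) 1 := ⟨by linarith [hz.2], by linarith [hz.1]⟩
  have hzb' : 1 - zb ∈ Ioo (0 : ℝ) 1 := ⟨by linarith [hzb.2], by linarith [hzb.1]⟩
  have A := (hasSum_isingData2D_blocks hz hzb).mul_left (((1 - z) * (1 - zb)) ^ (1 / 8 : ℝ))
  have B := (hasSum_isingData2D_blocks hz' hzb').mul_left ((-1) * (z * zb) ^ (1 / 8 : ℝ))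
  have AB := A.add B
  have e1 := ising_prefactor hz hzb (isingW₁ z) (isingW₁ zb)
  have e2 := ising_prefactor hz hzb (isingW₂ z) (isingW₂ zb)
  have e3 := ising_prefactor hz' hzb' (isingW₁ (1 - z)) (isingW₁ (1 - zb))
  have e4 := ising_prefactor hz' hzb' (isingW₂ (1 - z)) (isingW₂ (1 - zb))
  rw [show 1 - (1 - z) = z by ring, show 1 - (1 - zb) = zb by ring] at e3 e4
  have X := ising_crossing_identity hz hzb
  have hval : ((1 - z) * (1 - zb)) ^ (1 / 8 : ℝ) * ((isingF₁ z * isingF₁ zb - 1) + isingF₂ z * isingF₂ zb) +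
      (-1) * (z * zb) ^ (1 / 8 : ℝ) *
        ((isingF₁ (1 - z) * isingF₁ (1 - zb) - 1) + isingF₂ (1 - z) * isingF₂ (1 - zb)) =
      -(crossF (1 / 8) (-1) (fun _ _ => (1 : ℝ)) z zb) := by
    unfold isingF₁ isingF₂ at *
    rw [show 1 - (1 - z) = z by ring, show 1 - (1 - zb) = zb by ring]
    simp only [crossF]
    have HW : isingW₁ z * isingW₁ zb + isingW₂ z * isingW₂ zb =
        isingW₁ (1 - z) * isingW₁ (1 - zb) + isingW₂ (1 - z) * isingW₂ (1 - zb) := by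
      unfold isingW₁ isingW₂
      linear_combination (1 / 2 : ℝ) * X
    linear_combination e1 + e2 - e3 - e4 + HW
  rw [← hval]
  refine AB.congr_fun fun i => ?_
  simp only [crossF]
  ring

end Data

end Summit.CriticalPhenomena.Ising3D.Control2D
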